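import HarnessLib
import Summits.QuantumFields.YangMills.Theses.BalabanLadder
import Summits.QuantumFields.YangMills.Theorems.BalabanLadderUVSeamRecStubTransport
import Summits.QuantumFields.YangMills.Theorems.BalabanLadderUVSeamRecUnitTransfer
import Summits.QuantumFields.YangMills.Theorems.BalabanLadderUVSeamRecCeilingsResponseMomentsUnit
import Literature.MathematicalPhysics.QuantumLattice.RepLieAlgebraUnitary
import Summits.QuantumFields.YangMills.Theorems.BalabanLadderUVSeamRecColdWallDirichletRatePolyWindow
import Summits.QuantumFields.YangMills.Theorems.BalabanLadderUVSeamRecCarrierFlatGlue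
import Summits.QuantumFields.YangMills.Theorems.BalabanLadderUVSeamRecCarrierFlatWindow

/-! # LINE «coldwall-pure» for crux `UVSeamRec` (stmt-QuantumFields-20043) — RESHAPE 4 (LEAD ym-spine-20043-p1 g18, 2026-08-28):
# the measure side ADOPTS the β-free organs (SD)/(CM) of ym-idea-10's sibling line «classical_dominance», tail-only

Same composition `UVSeamRec_of` as the registered RESHAPE 2 (sha c86db84aa426ab4c); what changes is the CARRIER of the two measure-side binders.

WHY.  Located death K6 «BARE-COUPLING CARRIER» (PRIORITY: ideator ym-idea-10 g2, `Lines/af_carrier.lean` 05:34Z, idea-crit-9 VERDICT #13; repaired β-free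
by ym-idea-10 g3's `Lines/classical_dominance.lean` (SD)/(CM), VERDICT #24; CONFIRMED by the LEAD g18 with a kernel-checked kill criterion, memo
`FINDING-20043-g18-running-coupling.md`, HOME pub/ym-fleet/ym-spine-20043-p1/).  The registered second binder `stub_gaussianDomination : GaussianDominationSU2`
(and LEAD g17's RESHAPE-3 candidate `CarrierExpMomentsSU2`) weighs the classical centre response `cr` by the BARE coupling, `carrierCl C 1 β R = β·R⁴·cr/C`.
Under the torus state the slow modes at scale `R` carry the RUNNING coupling (`1/g²(R) = β/2 − 2b₀ log R + …`), so the torus mean of the bare-weighted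
carrier is `≍ 2κ·g²(R)/g₀²`, which at a FIXED PHYSICAL SIZE `R·uRec β = ℓ` (top of the femto window; `uRec = aΛ_L` two-loop) is `κ·β·g²_phys(ℓ) → ∞`;
the β-UNIFORM mean bounds that (GD) (`≤ 2e^{m₁+v₁/2}`, g16) and (EM_Q^∃) (`≤ C·B/2`, g17) imply therefore fail for every choice of constants (kernel-checked:
`ClassicalResponse.not_gaussianDominationSU2_of_carrierMean_unbounded`, `…not_carrierExpMomentsSU2_of_carrierMean_unbounded`, p646638).  The β-FREE carrier
`carrierCl C 1 1 R = R⁴·cr/C` has mean `≍ κ g²(R) ≤ κ g²_phys(ℓ₁)` — β-uniform — and LEAD g16's tilt inequality pays the classical part with coefficient ONE,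
so the bare weight `β` in the registered (CW) was idle slack.  RESHAPE 4 therefore replaces
  `{stub_coldWallSplitFemtoTail (payment β·R⁴cr/C_s), stub_gaussianDomination}` ↦ `{stub_classicalDominanceFemtoTail, stub_classicalMomentsFemtoTail}`:
* (SD-tail) ≡ (CW♭-tail) «`(R⁴/C₁)|kerE^η(plane) − kerE^𝟙(plane)| ≤ A₂ + carrierCl C_s 1 1 R`», i.e. classical_dominance's (SD) `|Δ| ≤ A·cr + κ/R⁴` with `A = C₁/C_s`,
  `κ = C₁A₂`, restricted to the TAIL `⌈β^{1/9}⌉ ≤ R + 2`: STRONGER than the registered (CW-tail) by the factor `β` in the payment; below the tail it is a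
  THEOREM for every exterior (`ColdWall.classicalDominance_window` g16 p636682, `ColdWall.coldWallSplitFlat_window` g18 p645871);
* (CM-tail) ≡ (EM♭-tail) «`⟨exp(2 Σ_{i∈T} carrierCl C 1 1 R (q i)(x i))⟩_{2L+1,β} ≤ e^{B·#T}`», i.e. classical_dominance's (CM) at `C₀ = C/2`, on the tail:
  WEAKER than (GD)/(EM_Q) and consistent with the running coupling; below the tail a THEOREM with ANY budget (`ColdWall.expMomentsFlat_window` p645871:
  LEAD g17's chessboard rung at the constant `C·β`, budget `12R⁴(2R+4)⁴(1944 + 144 log β/(2L+1))/(Cβ) → 0`);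
* glue (p646589 `…CarrierFlatGlue`): (CW♭) ⇒ registered (CW); (CW♭) ∧ (EM♭) ⇒ `DirichletRateSU2`, `ResponseMomentsOdd6SU2` (press p541348 at the β-free
  `Q β R q x := carrierCl C' 1 1 R q x`), so the registered `stub_coldWallSplit`, `stub_dirichletRate`, `stub_dirichletRateFemtoTail`, `stub_responseMomentsOdd6`,
  `stub_ceilings` stay THEOREMS of the skeleton by name (continuity of the DR instrument row and of the census names).
Stubs (sorries) = {`stub_classicalDominanceFemtoTail`, `stub_classicalMomentsFemtoTail`, `stub_floorsEngine`}; `stub_gaussianDomination` is DROPPED (dead organ,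
not weakened).  Relation to `Lines/classical_dominance.lean` (ym-idea-10 g3): same two measure organs; here their proved polynomial windows are folded out
(tail-only stubs) and the composition runs through tempered-d1's named (DR)/(RM) binders instead of the slack_coldwall pin chain.

HONEST FRAMING: a re-cut of OPEN conditional content plus kernel-checked glue; the two tail binders are XL (background-field expansion of one Dirichlet cube
kernel uniformly in `R ≤ ℓ/uRec β`, now WITHOUT factor-β slack for non-perturbative shells; Gaussian concentration of the classical centre response at the
RUNNING coupling); K6 itself is a one-loop heuristic, not a theorem; nothing of E0′, NT or a gap is claimed; YM mass gap NOT proved; not Clay.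
-/
namespace Summit.QuantumFields.YangMills.Cruxes.UVSeamRec.ColdWallPure

open Literature.MathematicalPhysics.QuantumFieldTheory
open Summit.QuantumFields.YangMills.Cruxes.OSLegsFromFemtoAndGap.DlrCollarTransfer
open Filter Topology
open scoped SchwartzMap
open Literature.MathematicalPhysics.QuantumLattice (thetaTest LGConfig fundamentalLatticeRep)
open Summit.QuantumFields.YangMills.Cruxes.UVSeamRec.ClassicalResponse
  (DirichletRate DirichletRateSU2 carrierCl coldWallSplit_of_coldWallSplitFlat dirichletRateSU2_of_coldWallSplitFlat_of_expMomentsFlat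
   responseMomentsOdd6SU2_of_coldWallSplitFlat_of_expMomentsFlat)

/-- The FUNDAMENTAL (defining) lattice representation of `SU(2)` (as v4-F/v5(α)). -/
abbrev rF : LatticeRep (Matrix.specialUnitaryGroup (Fin 2) ℂ) :=
  Literature.MathematicalPhysics.QuantumLattice.fundamentalLatticeRep 2

/-- the unit of record (abbreviation used only inside this skeleton). -/
noncomputable abbrev uRec : ℝ → ℝ := fun β => Real.exp (Summit.QuantumFields.YangMills.Theorems.FemtoTransferGap.sizeLog β 1)

/-- D0 (iso-transport) — PROVED (`Transport.stub_transport_proved`, p412513); text = v5(α) verbatim. -/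
theorem stub_transport :
    (letI : MeasurableSpace (Matrix.specialUnitaryGroup (Fin 2) ℂ) := borel _
     haveI : BorelSpace (Matrix.specialUnitaryGroup (Fin 2) ℂ) := ⟨rfl⟩
     ∃ r₂ : LatticeRep (Matrix.specialUnitaryGroup (Fin 2) ℂ),
       LowerBounds (Matrix.specialUnitaryGroup (Fin 2) ℂ) r₂ uRec ∧ MomentBounds6 (Matrix.specialUnitaryGroup (Fin 2) ℂ) r₂ uRec) →
    ∀ (G : Type) [Group G] [TopologicalSpace G] [IsTopologicalGroup G] [CompactSpace G],
      IsCompactSimpleLieGroup G → Nonempty (G ≃ₜ* Matrix.specialUnitaryGroup (Fin 2) ℂ) →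
      letI : MeasurableSpace G := borel G; haveI : BorelSpace G := ⟨rfl⟩;
      ∃ r : LatticeRep G, LowerBounds G r uRec ∧ MomentBounds6 G r uRec := by
  exact Summit.QuantumFields.YangMills.Cruxes.UVSeamRec.Transport.stub_transport_proved

/-- STUB (SD-tail) ≡ (CW♭-tail) «CLASSICAL DOMINANCE OF THE WALL INFLUENCE ON THE FEMTO TAIL» (ym-idea-10 g3's (SD) in the letters of the registered (CW),
β-FREE payment; XL; HARDEST of the measure side): `0 < C_s ≤ C₁`, `A₂ ≥ 0`,
`ℓ₂ > 0`, `β₂` such that for `β ≥ β₂`, every `R ≥ 1` with `⌈β^{1/9}⌉ ≤ R + 2` (the TAIL) and `R·uRec β ≤ ℓ₂` (the femto window), every `q`, `x` and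
EVERY exterior `η`: `(R⁴/C₁)|kerE^η(plane q x) − kerE^{𝟙}(plane q x)| ≤ A₂ + carrierCl rF C_s 1 1 R q x η` — «quantum response to the exterior ≤
A₂C₁/R⁴ + (C₁/C_s) × classical centre response», NO bare weight `β`.  Below the tail PROVED for every exterior (`ColdWall.coldWallSplitFlat_window`).
Heuristic size: quantum response = classical response × (1 + O(2b₀g₀² log R)) + O(g₀²/R⁴) (one loop in the background of the minimiser), so
`C_s = C₁/4`, `A₂ = O(1)` should do.  Why it might fail: an exterior family whose induced one-loop term at the centre exceeds a constant multiple
of its classical centre response by more than `A₂C₁/R⁴` (strongly non-perturbative shells with calm centre: the registered bare-weighted (CW) had a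
factor-`β` slack there, this stub has none), or non-uniformity of the background-field expansion in `R` up to `ℓ₂·e^{β/(4b₀)}`. -/
theorem stub_classicalDominanceFemtoTail :
    ∃ (C_s C₁ A₂ β₂ ℓ₂ : ℝ), 0 < C_s ∧ C_s ≤ C₁ ∧ 0 ≤ A₂ ∧ 0 < ℓ₂ ∧
      ∀ β : ℝ, β₂ ≤ β → ∀ R : ℕ, 1 ≤ R → ⌈β ^ (1 / 9 : ℝ)⌉₊ ≤ R + 2 → (R : ℝ) * Transport.uRec β ≤ ℓ₂ →
      ∀ (q : Fin 4 × Fin 4) (x : Fin 4 → ℤ), q.1 < q.2 → ∀ η : LGConfig 4 (Matrix.specialUnitaryGroup (Fin 2) ℂ),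
      (R : ℝ) ^ 4 / C₁ * |kerE (Matrix.specialUnitaryGroup (Fin 2) ℂ) (fundamentalLatticeRep 2) β (fun k => x k - (R + 1)) (2 * R + 3) η
          (plane (Matrix.specialUnitaryGroup (Fin 2) ℂ) (fundamentalLatticeRep 2) q x) -
        kerE (Matrix.specialUnitaryGroup (Fin 2) ℂ) (fundamentalLatticeRep 2) β (fun k => x k - (R + 1)) (2 * R + 3) 1
          (plane (Matrix.specialUnitaryGroup (Fin 2) ℂ) (fundamentalLatticeRep 2) q x)| ≤
        A₂ + carrierCl (fundamentalLatticeRep 2) C_s 1 1 R q x η := by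
  sorry

/-- (SD) ≡ (CW♭) «classical dominance ∕ β-free cold-wall split on the whole femto window» — a THEOREM of the skeleton: the elementary window (`ColdWall.coldWallSplitFlat_window`,
every exterior, `R + 1 ≤ ⌈β^{1/9}⌉`) glued to the tail stub (`ColdWall.coldWallSplitFlat_of_femtoTail`; `A₂ ↦ A₂ + 1`). -/
theorem stub_classicalDominance :
    ∃ (C_s C₁ A₂ β₂ ℓ₂ : ℝ), 0 < C_s ∧ 0 < C₁ ∧ 0 ≤ A₂ ∧ 0 < ℓ₂ ∧
      ∀ β : ℝ, β₂ ≤ β → ∀ R : ℕ, 1 ≤ R → (R : ℝ) * Transport.uRec β ≤ ℓ₂ →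
      ∀ (q : Fin 4 × Fin 4) (x : Fin 4 → ℤ), q.1 < q.2 → ∀ η : LGConfig 4 (Matrix.specialUnitaryGroup (Fin 2) ℂ),
      (R : ℝ) ^ 4 / C₁ * |kerE (Matrix.specialUnitaryGroup (Fin 2) ℂ) (fundamentalLatticeRep 2) β (fun k => x k - (R + 1)) (2 * R + 3) η
          (plane (Matrix.specialUnitaryGroup (Fin 2) ℂ) (fundamentalLatticeRep 2) q x) -
        kerE (Matrix.specialUnitaryGroup (Fin 2) ℂ) (fundamentalLatticeRep 2) β (fun k => x k - (R + 1)) (2 * R + 3) 1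
          (plane (Matrix.specialUnitaryGroup (Fin 2) ℂ) (fundamentalLatticeRep 2) q x)| ≤
        A₂ + carrierCl (fundamentalLatticeRep 2) C_s 1 1 R q x η :=
  Summit.QuantumFields.YangMills.Cruxes.UVSeamRec.ClassicalResponse.ColdWall.coldWallSplitFlat_of_femtoTail stub_classicalDominanceFemtoTail

/-- (CW) — the REGISTERED sentence of `stub_coldWallSplit` (bare-weighted carrier `carrierCl C_s 1 β R`), a THEOREM of the skeleton: (CW♭) is stronger
(`coldWallSplit_of_coldWallSplitFlat`, threshold `max β₂ 1`). Kept by name so that the registered sentence stays visible and checkable. -/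
theorem stub_coldWallSplit :
    ∃ (C_s C₁ A₂ β₂ ℓ₂ : ℝ), 0 < C_s ∧ 0 < C₁ ∧ 0 ≤ A₂ ∧ 0 < ℓ₂ ∧
      ∀ β : ℝ, β₂ ≤ β → ∀ R : ℕ, 1 ≤ R → (R : ℝ) * Transport.uRec β ≤ ℓ₂ →
      ∀ (q : Fin 4 × Fin 4) (x : Fin 4 → ℤ), q.1 < q.2 → ∀ η : LGConfig 4 (Matrix.specialUnitaryGroup (Fin 2) ℂ),
      (R : ℝ) ^ 4 / C₁ * |kerE (Matrix.specialUnitaryGroup (Fin 2) ℂ) (fundamentalLatticeRep 2) β (fun k => x k - (R + 1)) (2 * R + 3) η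
          (plane (Matrix.specialUnitaryGroup (Fin 2) ℂ) (fundamentalLatticeRep 2) q x) -
        kerE (Matrix.specialUnitaryGroup (Fin 2) ℂ) (fundamentalLatticeRep 2) β (fun k => x k - (R + 1)) (2 * R + 3) 1
          (plane (Matrix.specialUnitaryGroup (Fin 2) ℂ) (fundamentalLatticeRep 2) q x)| ≤
        A₂ + carrierCl (fundamentalLatticeRep 2) C_s 1 β R q x η :=
  coldWallSplit_of_coldWallSplitFlat stub_classicalDominance

/-- STUB (CM-tail) ≡ (EM♭-tail) «CLASSICAL-RESPONSE MOMENTS AT COEFFICIENT ONE ON THE FEMTO TAIL» (ym-idea-10 g3's (CM) with `C₀ = C/2`; XL; replaces the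
K6-dead `stub_gaussianDomination`): constants `C > 0`, `B`, `β₁`,
`ℓ₁ > 0` such that for `β ≥ β₁`, every odd torus `(ℤ/(2L+1))⁴`, every `R ≥ 1` with `⌈β^{1/9}⌉ ≤ R + 2` and `R·uRec β ≤ ℓ₁`, `4R+8 ≤ L`, every cyclically
`2R+4`-separated family and every `T`: `⟨exp(2 Σ_{i∈T} carrierCl rF C 1 1 R (q i) (x i))⟩_{2L+1,β} ≤ exp(B·#T)` — joint exponential moments of the
β-FREE classical centre responses `R⁴·cr_i/C`.  Below the tail PROVED with any budget (`ColdWall.expMomentsFlat_window`).  Calibration WITH the running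
coupling: `R⁴·cr ≍ κ·g²(R)·χ²` (`χ²` an `O(1)` quadratic form of the slow modes, `g²(R) ≤ g²_phys(ℓ₁)` on the window), so `C ≳ 4κ·v·g²_phys(ℓ₁)` and
`B = O(1)` — β-UNIFORM, unlike the bare-weighted `βR⁴cr` whose mean grows like `β·g²_phys(ℓ₁)` (kill criterion
`not_gaussianDominationSU2_of_carrierMean_unbounded`).  Why it might fail: non-Gaussian tails of the coherent flux at the running coupling on scales
up to `ℓ₁/uRec β` (instanton-like slow configurations have `R⁴cr = O(1)` and β-uniform but non-small density at physical scales — harmless for the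
exponential moment only if `C` absorbs them); uniformity in the torus size `L ≥ 4R+8` (torons). -/
theorem stub_classicalMomentsFemtoTail :
    ∃ (C B β₁ ℓ₁ : ℝ), 0 < C ∧ 0 < ℓ₁ ∧
      ∀ β : ℝ, β₁ ≤ β → ∀ (L n : ℕ) (q : Fin n → Fin 4 × Fin 4) (x : Fin n → (Fin 4 → ℤ)) (R : ℕ),
      (∀ i, (q i).1 < (q i).2) → 1 ≤ R → ⌈β ^ (1 / 9 : ℝ)⌉₊ ≤ R + 2 → (R : ℝ) * Transport.uRec β ≤ ℓ₁ → 4 * R + 8 ≤ L →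
      (∀ i j : Fin n, i ≠ j → ∃ k : Fin 4,
        (2 * (R : ℤ) + 4) ≤ |((((x i k - x j k : ℤ) : ZMod (2 * L + 1))).valMinAbs : ℤ)|) →
      ∀ T : Finset (Fin n),
        torusE (Matrix.specialUnitaryGroup (Fin 2) ℂ) (fundamentalLatticeRep 2) β L
          (fun U => Real.exp (((2 : ℕ) : ℝ) * ∑ i ∈ T, carrierCl (fundamentalLatticeRep 2) C 1 1 R (q i) (x i) U)) ≤
          Real.exp (B * T.card) := by
  sorry

/-- (CM) ≡ (EM♭) «classical-response moments on the whole femto window» — a THEOREM of the skeleton: the window theorem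
(`ColdWall.expMomentsFlat_window`, `θ = 1/9`, budget `1`) glued to the tail stub (`ColdWall.expMomentsFlat_of_femtoTail`; budget `max B 1`). -/
theorem stub_classicalMoments :
    ∃ (C B β₁ ℓ₁ : ℝ), 0 < C ∧ 0 < ℓ₁ ∧
      ∀ β : ℝ, β₁ ≤ β → ∀ (L n : ℕ) (q : Fin n → Fin 4 × Fin 4) (x : Fin n → (Fin 4 → ℤ)) (R : ℕ),
      (∀ i, (q i).1 < (q i).2) → 1 ≤ R → (R : ℝ) * Transport.uRec β ≤ ℓ₁ → 4 * R + 8 ≤ L →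
      (∀ i j : Fin n, i ≠ j → ∃ k : Fin 4,
        (2 * (R : ℤ) + 4) ≤ |((((x i k - x j k : ℤ) : ZMod (2 * L + 1))).valMinAbs : ℤ)|) →
      ∀ T : Finset (Fin n),
        torusE (Matrix.specialUnitaryGroup (Fin 2) ℂ) (fundamentalLatticeRep 2) β L
          (fun U => Real.exp (((2 : ℕ) : ℝ) * ∑ i ∈ T, carrierCl (fundamentalLatticeRep 2) C 1 1 R (q i) (x i) U)) ≤
          Real.exp (B * T.card) :=
  Summit.QuantumFields.YangMills.Cruxes.UVSeamRec.ClassicalResponse.ColdWall.expMomentsFlat_of_femtoTail stub_classicalMomentsFemtoTail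

/-- (DR) «DIRICHLET RATE LAW of the cold-wall plaquette mean» (tempered-d1's `ClassicalResponse.DirichletRateSU2`) — a THEOREM of the skeleton from the
two FLAT binders (`dirichletRateSU2_of_coldWallSplitFlat_of_expMomentsFlat`: torus DLR average of (CW♭), flat carrier mean `C·B/2` from (EM♭) by Jensen;
reference values = plaquette means of one big torus per `β`). -/
theorem stub_dirichletRate : DirichletRateSU2 :=
  dirichletRateSU2_of_coldWallSplitFlat_of_expMomentsFlat stub_classicalDominance stub_classicalMoments

/-- (DR-tail) — the LEAD g14 stub's sentence, a THEOREM of the skeleton (`ColdWall.femtoTail_of_dirichletRateSU2` applied to `stub_dirichletRate`). -/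
theorem stub_dirichletRateFemtoTail :
    ∃ (C₁ A₀ P₀ β₁ ℓ₁ : ℝ) (p : Fin 4 × Fin 4 → ℝ → ℝ), 0 < C₁ ∧ 0 ≤ A₀ ∧ 0 < ℓ₁ ∧ (∀ q β, |p q β| ≤ P₀) ∧
      ∀ β : ℝ, β₁ ≤ β → ∀ R : ℕ, 1 ≤ R → ⌈β ^ (1 / 100 : ℝ)⌉₊ ≤ R + 2 → (R : ℝ) * Transport.uRec β ≤ ℓ₁ →
        ∀ (q : Fin 4 × Fin 4) (x : Fin 4 → ℤ), q.1 < q.2 →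
          (R : ℝ) ^ 4 / C₁ * |kerE (Matrix.specialUnitaryGroup (Fin 2) ℂ) (fundamentalLatticeRep 2) β (fun k => x k - (R + 1)) (2 * R + 3)
              (1 : LGConfig 4 (Matrix.specialUnitaryGroup (Fin 2) ℂ))
              (plane (Matrix.specialUnitaryGroup (Fin 2) ℂ) (fundamentalLatticeRep 2) q x) - p q β| ≤ A₀ :=
  Summit.QuantumFields.YangMills.Cruxes.UVSeamRec.ClassicalResponse.ColdWall.femtoTail_of_dirichletRateSU2 (1 / 100) stub_dirichletRate

/-- (RM) — a THEOREM of the skeleton: the registered v5(α) text of `stub_responseMomentsOdd6` VERBATIM (`UV →` kept because it is the registered text;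
the hypothesis is not consumed), from (CW♭) ∧ (EM♭) through `responseMomentsOdd6SU2_of_coldWallSplitFlat_of_expMomentsFlat` (the (RM) press p541348
at the β-free carrier; `ResponseMomentsOdd6SU2` is the body by `Iff.rfl`). -/
theorem stub_responseMomentsOdd6 :
    Summit.QuantumFields.YangMills.Theses.BalabanLadder.UV →
      letI : MeasurableSpace (Matrix.specialUnitaryGroup (Fin 2) ℂ) := borel _
      haveI : BorelSpace (Matrix.specialUnitaryGroup (Fin 2) ℂ) := ⟨rfl⟩
      ∃ (a : ℝ → ℝ) (c : ℝ) (C₁ B β₁ ℓ₁ P₀ : ℝ) (p : Fin 4 × Fin 4 → ℝ → ℝ), 0 < c ∧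
      (∀ᶠ β in atTop, a β ≤ c * Transport.uRec β) ∧ 0 < ℓ₁ ∧ 0 < C₁ ∧ (∀ q β, |p q β| ≤ P₀) ∧
      ∀ β : ℝ, β₁ ≤ β → ∀ (L n : ℕ) (q : Fin n → Fin 4 × Fin 4) (x : Fin n → (Fin 4 → ℤ)) (R : ℕ),
      (∀ i, (q i).1 < (q i).2) → 1 ≤ R → (R : ℝ) * a β ≤ ℓ₁ → 4 * R + 8 ≤ L →
      (∀ i j : Fin n, i ≠ j → ∃ k : Fin 4,
      (2 * (R : ℤ) + 4) ≤ |((((x i k - x j k : ℤ) : ZMod (2 * L + 1))).valMinAbs : ℤ)|) →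
      ∀ T : Finset (Fin n),
      torusE (Matrix.specialUnitaryGroup (Fin 2) ℂ) (Literature.MathematicalPhysics.QuantumLattice.fundamentalLatticeRep 2) β L
      (fun U => Real.exp (∑ i ∈ T, (R : ℝ) ^ 4 / C₁ *
      |kerE (Matrix.specialUnitaryGroup (Fin 2) ℂ) (Literature.MathematicalPhysics.QuantumLattice.fundamentalLatticeRep 2) β
      (fun k => x i k - (R + 1)) (2 * R + 3) U
      (plane (Matrix.specialUnitaryGroup (Fin 2) ℂ) (Literature.MathematicalPhysics.QuantumLattice.fundamentalLatticeRep 2) (q i) (x i)) -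
      p (q i) β|)) ≤ Real.exp (B * T.card) :=
  fun _ => responseMomentsOdd6SU2_of_coldWallSplitFlat_of_expMomentsFlat stub_classicalDominance stub_classicalMoments

/-- E0′ ceilings — a THEOREM of the skeleton (as v5(α)): (RM) through the landed press-button `TemperedResponse.stubCeilings_of_responseMoments`
(p532738).  Statement = v4-F's `stub_ceilings` VERBATIM. -/
theorem stub_ceilings :
    Summit.QuantumFields.YangMills.Theses.BalabanLadder.UV →
      letI : MeasurableSpace (Matrix.specialUnitaryGroup (Fin 2) ℂ) := borel _
      haveI : BorelSpace (Matrix.specialUnitaryGroup (Fin 2) ℂ) := ⟨rfl⟩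
      MomentBounds6 (Matrix.specialUnitaryGroup (Fin 2) ℂ) rF uRec :=
  fun hUV => Summit.QuantumFields.YangMills.Cruxes.UVSeamRec.TemperedResponse.stubCeilings_of_responseMoments
    (stub_responseMomentsOdd6 hUV)

/-- STUB F-B∧F-C «compact-witness floors at an asymptotically-two-loop engine unit» (XL; NO `UV`; BYTE-IDENTICAL to v5(α)/v7c/v8c/v8d; = the engine
data of the landed per-representation transfer `UnitTransfer.lowerBounds_uRec_of_engine rF`, p441552): the FUNDAMENTAL representation `rF` of `SU(2)` and
a unit map `a` with `a β / uRec β → c₀ > 0` carrying the `Q2`/`Q3` floors with COMPACTLY SUPPORTED witnesses.  Supplier: the NT line's conditional femto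
package at `SU(2)`-fundamental (19353 `stub_cfp : CFP` engine E1–E3; landed discharge `FloorsEngineOfWindow.floorsEngine_of_fcp_commensurable rF a …`,
p448741).  NOT rescued by this line (its rescue is a line on 19353).  Why it might fail: as NT (19353) — a β-uniform floor is dimensional transmutation
(barrier PerturbativeInvisibility) — plus the scaling of the non-perturbative unit (Patrascioiu–Seiler vs. consensus). -/
theorem stub_floorsEngine :
    letI : MeasurableSpace (Matrix.specialUnitaryGroup (Fin 2) ℂ) := borel _
    haveI : BorelSpace (Matrix.specialUnitaryGroup (Fin 2) ℂ) := ⟨rfl⟩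
    ∃ (a : ℝ → ℝ) (c₀ : ℝ), 0 < c₀ ∧ (∀ β, 0 < a β) ∧
      Tendsto (fun β => a β / uRec β) atTop (𝓝 c₀) ∧
      (∃ (v : 𝓢(EuclideanSpace ℝ (Fin 4), ℝ)) (ε β₅ Λ₅ : ℝ),
        HasCompactSupport (v : EuclideanSpace ℝ (Fin 4) → ℝ) ∧
        tsupport (v : EuclideanSpace ℝ (Fin 4) → ℝ) ⊆ {y : EuclideanSpace ℝ (Fin 4) | 0 < y 0} ∧ 0 < ε ∧
        ∀ β : ℝ, β₅ ≤ β → ∀ L : ℕ, Λ₅ ≤ a β * L →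
          ε ≤ Q2 (Matrix.specialUnitaryGroup (Fin 2) ℂ) rF β L (a β) (thetaTest 4 v) v) ∧
      (∃ (f g h : 𝓢(EuclideanSpace ℝ (Fin 4), ℝ)) (ε β₅ Λ₅ : ℝ),
        HasCompactSupport (f : EuclideanSpace ℝ (Fin 4) → ℝ) ∧
        HasCompactSupport (g : EuclideanSpace ℝ (Fin 4) → ℝ) ∧
        HasCompactSupport (h : EuclideanSpace ℝ (Fin 4) → ℝ) ∧
        Disjoint (tsupport (f : EuclideanSpace ℝ (Fin 4) → ℝ)) (tsupport (g : EuclideanSpace ℝ (Fin 4) → ℝ)) ∧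
        Disjoint (tsupport (g : EuclideanSpace ℝ (Fin 4) → ℝ)) (tsupport (h : EuclideanSpace ℝ (Fin 4) → ℝ)) ∧
        Disjoint (tsupport (f : EuclideanSpace ℝ (Fin 4) → ℝ)) (tsupport (h : EuclideanSpace ℝ (Fin 4) → ℝ)) ∧
        0 < ε ∧ ∀ β : ℝ, β₅ ≤ β → ∀ L : ℕ, Λ₅ ≤ a β * L →
          ε ≤ |Q3 (Matrix.specialUnitaryGroup (Fin 2) ℂ) rF β L (a β) f g h|) := by
  sorry

/-- COMPOSITION (kernel-checked, closed form): ceilings ⊕ engine floors ⊕ LANDED unit transfer ⊕ transport ⇒ the item BY NAME. -/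
theorem UVSeamRec_of : Summit.QuantumFields.YangMills.Theses.BalabanLadder.UVSeamRec := by
  intro hUV G _ _ _ _ hG hcl
  letI : MeasurableSpace (Matrix.specialUnitaryGroup (Fin 2) ℂ) := borel _
  haveI : BorelSpace (Matrix.specialUnitaryGroup (Fin 2) ℂ) := ⟨rfl⟩
  have hc := stub_ceilings hUV
  obtain ⟨a, c₀, hc₀, ha, hau, h2, h3⟩ := stub_floorsEngine
  have hlb := Summit.QuantumFields.YangMills.Cruxes.UVSeamRec.UnitTransfer.lowerBounds_uRec_of_engine rF hc₀ ha hau hc h2 h3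
  exact stub_transport ⟨rF, hlb, hc⟩ G hG hcl

end Summit.QuantumFields.YangMills.Cruxes.UVSeamRec.ColdWallPure
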